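import Mathlib
import Summits.KontsevichZagierPeriods.Zeta5Search.LaiBoxDimension
import Literature.NumberTheory.Irrationality.FischlerZudilin2010.OddZetaDim139
import HarnessLib

/-!
# The printed rung of the κ₃ ladder: `κ₃ ≤ 139` as a hypothesis on `oddZetaSpanRank`

HONEST FRAMING: systematic search; no irrationality claim unless certified. Pub cell `pub-zeta5`, lane
fam-indep (`families/indep/FAMILY.md` §5.11–§5.12). FILE AFTER `Zeta5Search/LaiBoxDimension.lean` and
`Literature/NumberTheory/Irrationality/FischlerZudilin2010/OddZetaDim139.lean` (both staged in the same
folder); the text below was kernel-checked with an inline copy of the named fact (scratch, rc 0).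

`oddZetaSpanRank m = dim_ℚ Span_ℚ(1, ζ(3), …, ζ(2m+1))` (`LaiBoxDimension.lean`). The record in print,
Fischler–Zudilin's `dim_ℚ Span_ℚ(1, ζ(3), …, ζ(139)) ≥ 3` [FischlerZudilin2010, §3.1], is the tree's named
fact `FischlerZudilin2010.oddZetaDim139` (statement only); under it every rung `m ≥ 69` holds. Rungs
`m < 69` are OPEN in print ([Lai2024BallRivoal, Claim 1.4] claims `m = 37`); nothing is asserted for them.
-/

noncomputable section

namespace Summit.KontsevichZagierPeriods.Zeta5Search

open Literature.NumberTheory.Irrationality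

/-- The printed rung: `κ₃ ≤ 139` [FischlerZudilin2010, §3.1] gives `3 ≤ oddZetaSpanRank 69`
(hypothesis `h` = the named fact, not proved in the tree). -/
theorem three_le_oddZetaSpanRank_69_of_fischlerZudilin (h : FischlerZudilin2010.oddZetaDim139) :
    3 ≤ oddZetaSpanRank 69 := by
  rw [oddZetaSpanRank_eq_finrank_span_insert]; exact h

/-- … and hence every rung `m ≥ 69` of the ladder (monotonicity `oddZetaSpanRank_mono`). -/
theorem three_le_oddZetaSpanRank_of_fischlerZudilin (h : FischlerZudilin2010.oddZetaDim139) {m : ℕ}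
    (hm : 69 ≤ m) : 3 ≤ oddZetaSpanRank m :=
  (three_le_oddZetaSpanRank_69_of_fischlerZudilin h).trans (oddZetaSpanRank_mono hm)

end Summit.KontsevichZagierPeriods.Zeta5Search
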